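import Summits.HodgeConjecture.HodgeConjecture.Theorems.SixfoldTableXCensusIsogeny
import Summits.HodgeConjecture.HodgeConjecture.Theorems.SixfoldTableXClasses
import Literature.AlgebraicGeometry.HodgeTheory.NoTypeIVTimesCMProductSpan
import Literature.AlgebraicGeometry.HodgeTheory.TimesNonCMCurveProductSpan
import Literature.AlgebraicGeometry.HodgeTheory.TimesGenericStablyNondegenerateProductSpan
import Literature.AlgebraicGeometry.HodgeTheory.NoTypeIVFactorProducts
import Literature.AlgebraicGeometry.HodgeTheory.NoTypeIVFactorSubvarietiesQuotients
import Literature.AlgebraicGeometry.HodgeTheory.NoTypeIVTimesCMStablyNondegenerate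
import Literature.AlgebraicGeometry.Milne1999.CMTypeSubquotients
import Literature.AlgebraicTopology.SingularHomology.CupProductProofs
import HarnessLib

/-!
# TABLE X (dimension 6) — the census nodes X2 / X1 DISCHARGED IN THE KERNEL on the KÜNNETH rows
# (`B(B × C)` spanned by exterior products), unconditionally (cell `pub-hodgeav-hg6`, req-37 (A) Q2b; eng-4 g3)

HONEST FRAMING. HC, `HC_AV` (stmt-1333), `HC_CM` (stmt-3052) and the rung H2 are NOT proved and do not occur here. The
census nodes `TableX.SixfoldCodimTwoCensus` (X2) / `TableX.SixfoldCodimThreeCensus` (X1) of `SixfoldTableXCover` are OURS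
(`@[conjecture]`), never asserted. KERNEL ONLY: theorems over existing declarations; no definition, no `sorry`, no new
named fact; every input is a THEOREM of the tree.

WHY THIS MODULE (census-node self-audit, axis A7 «a row VERIFIED in the kernel, not by dossier», continued). L8
(`SixfoldTableXCensusEllipticRows`) verified the per-variety conclusions of X2 / X1 on the elliptic-product rows, where
they hold by the DIVISOR summand alone (`B = D`). Here the other elementary mechanism of TABLE X is run in the kernel:
the KÜNNETH rows — a sixfold `A ∼ B × C` (`0 < dim B`, `0 < dim C`) whose rational Hodge classes are spanned by the
exterior products `pr_B^* a ∪ pr_C^* b` of rational Hodge classes of the factors (the tree's predicate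
`HodgeClassesProductSpan B C`, Moonen–Zarhin 1999 §3 (3.1): «`B(X₁ × X₂)` is generated by the elements coming from
`B(X₁)` and `B(X₂)`», which holds when `Hg(X₁ × X₂) = Hg(X₁) × Hg(X₂)`). On such a row the nodes hold by the divisor
summand AND THE PULL-BACK / CUP-PRODUCT SUMMANDS: a generator of `H⁴` has `(deg a, deg b) ∈ {(0,4), (2,2), (4,0)}` and is
a multiple of the pull-back `pr_C^* b` of a rational `(2,2)`-class of `C` (`dim C < 6`; `H⁰(B) = ℂ·1`), a product of two
divisor classes, or a multiple of `pr_B^* a`; a generator of `H⁶` has `(deg a, deg b) ∈ {(0,6), (2,4), (4,2), (6,0)}` and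
is a pull-back of a rational `(3,3)`-class from a factor or — after graded commutation in the case `(2,4)` — a cup product
(rational `(2,2)`-class)·(rational `(1,1)`-class). SCOPE GUARD: the generators of `HodgeClassesProductSpan` are
products `pr_B^* a ∪ pr_C^* b` with `a`, `b` RATIONAL classes of Hodge type `(l,l)`, `(k,k)` on the factors (the tree's
`hodgeProductClasses`), so a bidegree-`(2,2)` generator is a product of two pulled-back RATIONAL `(1,1)`-classes, i.e. of
two divisor classes (Lefschetz `(1,1)`, the tree's `mem_divisorClassesSpan_one`) — it lands in the divisor summand with no
further input; every other generator lands in the pull-back or the cup-product summand as said. The template is the tree's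
fivefold Künneth row `isCodimTwoDivisorPullbackGenerated_prod_curve_of_productSpan` (Moonen–Zarhin Thm. 0.2, §5
(5.10)–(5.12)). L8's entry points `codimTwo/ThreeCensusAt_of_divisorial` do NOT fit these rows (they are not `B = D` rows:
the pull-back and cup-product summands are genuinely used), so §1 is the Künneth entry point; nothing of L8 is restated, and
every declaration lives in the sub-namespace `TableX.ProductRows` (lead g2 dedup rule 2026-08-28T20:17:40Z), import-
independent of the simple-rows module L10.

* §1 `codimTwoCensusAt_prod_of_productSpan`, `codimThreeCensusAt_prod_of_productSpan`: X2- / X1-conclusion at `B × C`;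
  `census_of_isIsogenous_prod_of_productSpan`: both, at every `A ∼ B × C` (L7b transport).
* §2 INSTANCES from PROVED product-span theorems of the tree (no named fact enters):
  (a) `census_of_isIsogenous_prod_of_hasNoTypeIVFactor_of_isOfCMType` — `B` without simple factor of type IV, `C` of CM
  type (Lombardo 2016 Lemma 3.4 + Moonen–Zarhin (3.1), the tree's THEOREM `Lombardo2016_hodgeClassesProductSpan_holds`):
  the TABLE X rows «type I/II/III factor × CM factor» (`E_k ×` I/II/III-fivefold, CM surface × I/II/III-fourfold, …);
  (b) `census_of_isIsogenous_prod_nonCMCurve` — any `B` times an elliptic curve `E` with `End⁰(E) = ℚ` and `Hom(B, E) = 0`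
  (Moonen–Zarhin Prop. (3.8) / Lemma (3.4), the tree's `hodgeClassesProductSpan_of_nonCMCurve_of_forall_hom_eq_zero`);
  (c) `census_of_isIsogenous_prod_genericStablyNondegenerate` — any `B` times a stably nondegenerate `S` with
  `End⁰(S) = ℚ` and `Hom(B, S) = 0` (Hazama / Moonen–Zarhin (2.4), (3.1)).
* §3 THESE ROWS ARE OFF THE RESIDUE (so they are rows the nodes actually claim): `not_residueClass_of_isIsogenous_prod_…`
  — a product with a non-CM factor is not of CM type (Milne 1999 §2: CM type passes to factors), and it is not in the
  K3-partner cell: a simple type-IV quartic-field fourfold `Y` with `A ∼ Y × Z`, `Z` a CM surface, would be a simple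
  isogeny factor of `B` (impossible when `B` has no factor of type IV: `HasNoTypeIVFactor` passes to abelian subvarieties)
  or of the CM factor (then `End⁰(Y)` would have degree `2 dim Y = 8`, not `4`); for row (b) the non-CM curve `E` would be
  a simple isogeny factor of `Y` (dimensions) or of `Z` (CM) — both absurd (`𝒞` spelled exactly as in L6 / L7).
  The dimension-6 assembly `(dim A = 6 ∧ ¬ 𝒞 A) ∧ X2-at-A ∧ X1-at-A` and the FLOOR reading of these rows (L6's
  conclusion from Markman's fourfold theorem alone, TABLE X verdict `floorProduct`) are the sequel module
  `SixfoldTableXCensusProductRowsSix`.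

Nothing here is a corollary of `HC_CM`; no hypothesis of the cover is discharged GLOBALLY (X2 / X1 stay `@[conjecture]`:
they quantify over ALL off-residue sixfolds — the Weil-carrier and type-IV-interaction rows are NOT Künneth rows); typed ≠
proved.
-/

set_option linter.dupNamespace false

noncomputable section

open CategoryTheory MonoidalCategory CartesianMonoidalCategory
open Literature.AlgebraicGeometry Literature.AlgebraicGeometry.Motives
open Literature.AlgebraicGeometry.Motives.AbelianVariety (IsIsogenous IsIsogeny)
open Literature.AlgebraicGeometry.HodgeTheory
open Literature.AlgebraicGeometry.Milne1999
open Literature.AlgebraicTopology.SingularHomology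
open Literature.Barriers.HodgeConjecture
open Summit.HodgeConjecture.HodgeConjecture.Ring2.ClassTargets
open Summit.HodgeConjecture.HodgeConjecture.Ring2.Motiv (ProdCMCell)
open Summit.HodgeConjecture.HodgeConjecture.Ring2.Atlas (IsQuarticFieldTypeIVFourfold)

namespace Summit.HodgeConjecture.HodgeConjecture.TableX.ProductRows

/-! ## §1 The Künneth row: product span gives both census conclusions at `B × C` and on its isogeny class -/

/-- **X2 AT A KÜNNETH ROW.** If the rational Hodge classes of `B × C` (`0 < dim B`, `0 < dim C`) are spanned by the
exterior products of rational Hodge classes of the factors, every rational `(2,2)`-class of `B × C` lies in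
`D²(B × C) ⊗ ℂ ⊔ span {g^* w : g : (B × C).X ⟶ C'.X, dim C' < dim (B × C), w rational (2,2) on C'}`: a generator
`pr_B^* a ∪ pr_C^* b` with `deg a = 0` is `t · pr_C^* b` (`H⁰(B(ℂ); ℂ) = ℂ·1`, `pr_B^* 1 = 1`, `1 ∪ x = x`), with
`deg a = deg b = 2` a product of two divisor classes, with `deg b = 0` it is `t · pr_B^* a`.
[cite: MoonenZarhin1999LowDim, §3 (3.1) and §5 (5.10)–(5.12)] [cite: HatcherAT2002, §3.2 Prop. 3.10 and p. 211] -/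
theorem codimTwoCensusAt_prod_of_productSpan {B C : AbelianVariety ℂ} (hB : 0 < B.dim) (hC : 0 < C.dim)
    (hS : HodgeClassesProductSpan B C) :
    ∀ c : complexBetti (B.prod C).X (2 * 2), IsRationalClass c →
      IsOfHodgeType (B.prod C).dim (B.prod C).X (2 * 2) 2 2 c →
      c ∈ divisorClassesSpan (B.prod C).X (B.prod C).dim 2 ⊔ Submodule.span ℂ {w' : complexBetti (B.prod C).X (2 * 2) |
        ∃ (C' : AbelianVariety ℂ) (g : (B.prod C).X ⟶ C'.X) (w : complexBetti C'.X (2 * 2)), C'.dim < (B.prod C).dim ∧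
          IsRationalClass w ∧ IsOfHodgeType C'.dim C'.X (2 * 2) 2 2 w ∧ w' = complexBetti.map g (2 * 2) w} := by
  have hBs : IsSmoothProjective B.dim B.X := AbelianVariety.isSmoothProjective_holds
  have hCs : IsSmoothProjective C.dim C.X := AbelianVariety.isSmoothProjective_holds
  have hdimB : B.dim < (B.prod C).dim := by rw [AbelianVariety.dim_prod]; omega
  have hdimC : C.dim < (B.prod C).dim := by rw [AbelianVariety.dim_prod]; omega
  intro c hc hH
  rw [AbelianVariety.dim_prod] at hH
  refine (Submodule.span_le.2 ?_) (hS 2 c hc hH)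
  rintro x ⟨l, k, hlk, a, b, ha, ha', hb, hb', rfl⟩
  have hl : l ≤ 2 := by omega
  interval_cases l
  · -- `(deg a, deg b) = (0, 4)`: `a = t • 1`, the class is `t • pr_C^* b`
    obtain rfl : k = 2 := by omega
    have ha1 : a ∈ Submodule.span ℂ {singularCohomology.one ℂ (ComplexPoints B.X)} :=
      mem_divisorClassesSpan_zero (N := B.dim) hBs a
    obtain ⟨t, rfl⟩ := Submodule.mem_span_singleton.1 ha1
    rw [map_smul, map_smul, LinearMap.smul_apply]
    refine Submodule.smul_mem _ t (Submodule.mem_sup_right (Submodule.subset_span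
      ⟨C, snd B.X C.X, b, hdimC, hb, hb', ?_⟩))
    have h1 : complexBetti.map (fst B.X C.X) (2 * 0) (singularCohomology.one ℂ (ComplexPoints B.X)) =
        singularCohomology.one ℂ (ComplexPoints (B.X ⊗ C.X)) :=
      singularCohomology.map_one _
    rw [h1]
    exact one_cupProduct _
  · -- `(2, 2)`: a product of two divisor classes
    obtain rfl : k = 1 := by omega
    exact Submodule.mem_sup_left (cupProduct_mem_divisorClassesSpan_of_mem (by norm_num) hlk
      (AbelianVariety.map_mem_divisorClassesSpan (AbelianVariety.fst B C) (mem_divisorClassesSpan_one ha ha'))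
      (AbelianVariety.map_mem_divisorClassesSpan (AbelianVariety.snd B C) (mem_divisorClassesSpan_one hb hb')))
  · -- `(4, 0)`: `b = t • 1`, the class is `t • pr_B^* a`
    obtain rfl : k = 0 := by omega
    have hb1 : b ∈ Submodule.span ℂ {singularCohomology.one ℂ (ComplexPoints C.X)} :=
      mem_divisorClassesSpan_zero (N := C.dim) hCs b
    obtain ⟨t, rfl⟩ := Submodule.mem_span_singleton.1 hb1
    rw [map_smul, map_smul]
    refine Submodule.smul_mem _ t (Submodule.mem_sup_right (Submodule.subset_span
      ⟨B, fst B.X C.X, a, hdimB, ha, ha', ?_⟩))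
    have h1 : complexBetti.map (snd B.X C.X) (2 * 0) (singularCohomology.one ℂ (ComplexPoints C.X)) =
        singularCohomology.one ℂ (ComplexPoints (B.X ⊗ C.X)) :=
      singularCohomology.map_one _
    rw [h1]
    exact cupProduct_one _

/-- **X1 AT A KÜNNETH ROW.** Under the same hypothesis every rational `(3,3)`-class of `B × C` lies in the four-summand
span of the codimension-3 node: a generator `pr_B^* a ∪ pr_C^* b` with `deg a = 0` (resp. `deg b = 0`) is a multiple
of the pull-back of a rational `(3,3)`-class from `C` (resp. `B`), one with `(deg a, deg b) = (4, 2)` is a cup product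
(rational `(2,2)`-class)·(rational `(1,1)`-class) of pull-backs, and one with `(2, 4)` is such a cup product after
graded commutation (`x ∪ y = (-1)^{2·4} y ∪ x`). The divisor and Weil summands are not needed.
[cite: MoonenZarhin1999LowDim, §3 (3.1) and §5 (5.10)–(5.12)] [cite: HatcherAT2002, §3.2 Thm. 3.11, Prop. 3.10 and p. 211] -/
theorem codimThreeCensusAt_prod_of_productSpan {B C : AbelianVariety ℂ} (hB : 0 < B.dim) (hC : 0 < C.dim)
    (hS : HodgeClassesProductSpan B C) :
    ∀ c : complexBetti (B.prod C).X (2 * 3), IsRationalClass c →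
      IsOfHodgeType (B.prod C).dim (B.prod C).X (2 * 3) 3 3 c →
      c ∈ divisorClassesSpan (B.prod C).X (B.prod C).dim 3 ⊔ Submodule.span ℂ {w' : complexBetti (B.prod C).X (2 * 3) |
          ∃ (a : complexBetti (B.prod C).X (2 * 2)) (b : complexBetti (B.prod C).X (2 * 1)),
            IsRationalClass a ∧ IsOfHodgeType (B.prod C).dim (B.prod C).X (2 * 2) 2 2 a ∧ IsRationalClass b ∧
            IsOfHodgeType (B.prod C).dim (B.prod C).X (2 * 1) 1 1 b ∧ w' = cupProduct (two_mul_add_two_mul 2 1) a b} ⊔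
        Submodule.span ℂ {w' : complexBetti (B.prod C).X (2 * 3) |
          ∃ (C' : AbelianVariety ℂ) (g : (B.prod C).X ⟶ C'.X) (w : complexBetti C'.X (2 * 3)), C'.dim < (B.prod C).dim ∧
            IsRationalClass w ∧ IsOfHodgeType C'.dim C'.X (2 * 3) 3 3 w ∧ w' = complexBetti.map g (2 * 3) w} ⊔
        Submodule.span ℂ {w' : complexBetti (B.prod C).X (2 * 3) |
          ∃ (B' : AbelianVariety ℂ) (g : (B.prod C).X ⟶ B'.X) (d : ℕ) (ψ : B' ⟶ B') (w : complexBetti B'.X (2 * 3)),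
            B'.dim = 6 ∧ 0 < d ∧ ψ ≫ ψ = -(d • 𝟙 B') ∧ IsRationalClass w ∧
            IsOfHodgeType B'.dim B'.X (2 * 3) 3 3 w ∧ w ∈ weilClassesOf B' ψ 3 d ∧
            w' = complexBetti.map g (2 * 3) w} := by
  have hBs : IsSmoothProjective B.dim B.X := AbelianVariety.isSmoothProjective_holds
  have hCs : IsSmoothProjective C.dim C.X := AbelianVariety.isSmoothProjective_holds
  have hdimB : B.dim < (B.prod C).dim := by rw [AbelianVariety.dim_prod]; omega
  have hdimC : C.dim < (B.prod C).dim := by rw [AbelianVariety.dim_prod]; omega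
  intro c hc hH
  rw [AbelianVariety.dim_prod] at hH
  refine (Submodule.span_le.2 ?_) (hS 3 c hc hH)
  rintro x ⟨l, k, hlk, a, b, ha, ha', hb, hb', rfl⟩
  have hl : l ≤ 3 := by omega
  interval_cases l
  · -- `(0, 6)`: `a = t • 1`, the class is `t • pr_C^* b`, a pull-back from `C`
    obtain rfl : k = 3 := by omega
    have ha1 : a ∈ Submodule.span ℂ {singularCohomology.one ℂ (ComplexPoints B.X)} :=
      mem_divisorClassesSpan_zero (N := B.dim) hBs a
    obtain ⟨t, rfl⟩ := Submodule.mem_span_singleton.1 ha1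
    rw [map_smul, map_smul, LinearMap.smul_apply]
    refine Submodule.smul_mem _ t (Submodule.mem_sup_left (Submodule.mem_sup_right (Submodule.subset_span
      ⟨C, snd B.X C.X, b, hdimC, hb, hb', ?_⟩)))
    have h1 : complexBetti.map (fst B.X C.X) (2 * 0) (singularCohomology.one ℂ (ComplexPoints B.X)) =
        singularCohomology.one ℂ (ComplexPoints (B.X ⊗ C.X)) :=
      singularCohomology.map_one _
    rw [h1]
    exact one_cupProduct _
  · -- `(2, 4)`: graded-commute to `pr_C^* b ∪ pr_B^* a`, a `(2,2)·(1,1)` cup product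
    obtain rfl : k = 2 := by omega
    have ha2 := AbelianVariety.mapsTo_hodgeClasses (AbelianVariety.fst B C) 1 ⟨ha, ha'⟩
    have hb2 := AbelianVariety.mapsTo_hodgeClasses (AbelianVariety.snd B C) 2 ⟨hb, hb'⟩
    rw [cupProduct_gradedComm_holds ℂ _ hlk (two_mul_add_two_mul 2 1)]
    have hsign : (-1 : ℂ) ^ (2 * 1 * (2 * 2)) = 1 := by norm_num
    rw [hsign, one_smul]
    exact Submodule.mem_sup_left (Submodule.mem_sup_left (Submodule.mem_sup_right (Submodule.subset_span
      ⟨_, _, hb2.1, hb2.2, ha2.1, ha2.2, rfl⟩)))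
  · -- `(4, 2)`: a `(2,2)·(1,1)` cup product of pull-backs
    obtain rfl : k = 1 := by omega
    have ha2 := AbelianVariety.mapsTo_hodgeClasses (AbelianVariety.fst B C) 2 ⟨ha, ha'⟩
    have hb2 := AbelianVariety.mapsTo_hodgeClasses (AbelianVariety.snd B C) 1 ⟨hb, hb'⟩
    exact Submodule.mem_sup_left (Submodule.mem_sup_left (Submodule.mem_sup_right (Submodule.subset_span
      ⟨_, _, ha2.1, ha2.2, hb2.1, hb2.2, rfl⟩)))
  · -- `(6, 0)`: `b = t • 1`, the class is `t • pr_B^* a`, a pull-back from `B`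
    obtain rfl : k = 0 := by omega
    have hb1 : b ∈ Submodule.span ℂ {singularCohomology.one ℂ (ComplexPoints C.X)} :=
      mem_divisorClassesSpan_zero (N := C.dim) hCs b
    obtain ⟨t, rfl⟩ := Submodule.mem_span_singleton.1 hb1
    rw [map_smul, map_smul]
    refine Submodule.smul_mem _ t (Submodule.mem_sup_left (Submodule.mem_sup_right (Submodule.subset_span
      ⟨B, fst B.X C.X, a, hdimB, ha, ha', ?_⟩)))
    have h1 : complexBetti.map (snd B.X C.X) (2 * 0) (singularCohomology.one ℂ (ComplexPoints C.X)) =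
        singularCohomology.one ℂ (ComplexPoints (B.X ⊗ C.X)) :=
      singularCohomology.map_one _
    rw [h1]
    exact cupProduct_one _

/-- **Both census conclusions on the ISOGENY CLASS of a Künneth row**: every `A ∼ B × C` (`0 < dim B`, `0 < dim C`,
`HodgeClassesProductSpan B C`) satisfies the X2- and the X1-conclusion (transport by L7b
`codimTwoCensusAt_iff_of_isIsogenous` / `codimThreeCensusAt_iff_of_isIsogenous`).
[cite: MoonenZarhin1999LowDim, §3 (3.1) and §5 (5.1)] [cite: vanGeemen1994HodgeAV, 3.6–3.7] -/
theorem census_of_isIsogenous_prod_of_productSpan {A B C : AbelianVariety ℂ} (hB : 0 < B.dim) (hC : 0 < C.dim)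
    (hS : HodgeClassesProductSpan B C) (hA : IsIsogenous A (B.prod C)) :
    (∀ c : complexBetti A.X (2 * 2), IsRationalClass c → IsOfHodgeType A.dim A.X (2 * 2) 2 2 c →
      c ∈ divisorClassesSpan A.X A.dim 2 ⊔ Submodule.span ℂ {w' : complexBetti A.X (2 * 2) |
        ∃ (C : AbelianVariety ℂ) (g : A.X ⟶ C.X) (w : complexBetti C.X (2 * 2)), C.dim < A.dim ∧
          IsRationalClass w ∧ IsOfHodgeType C.dim C.X (2 * 2) 2 2 w ∧ w' = complexBetti.map g (2 * 2) w}) ∧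
    (∀ c : complexBetti A.X (2 * 3), IsRationalClass c → IsOfHodgeType A.dim A.X (2 * 3) 3 3 c →
      c ∈ divisorClassesSpan A.X A.dim 3 ⊔ Submodule.span ℂ {w' : complexBetti A.X (2 * 3) |
          ∃ (a : complexBetti A.X (2 * 2)) (b : complexBetti A.X (2 * 1)),
            IsRationalClass a ∧ IsOfHodgeType A.dim A.X (2 * 2) 2 2 a ∧ IsRationalClass b ∧
            IsOfHodgeType A.dim A.X (2 * 1) 1 1 b ∧ w' = cupProduct (two_mul_add_two_mul 2 1) a b} ⊔
        Submodule.span ℂ {w' : complexBetti A.X (2 * 3) |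
          ∃ (C : AbelianVariety ℂ) (g : A.X ⟶ C.X) (w : complexBetti C.X (2 * 3)), C.dim < A.dim ∧
            IsRationalClass w ∧ IsOfHodgeType C.dim C.X (2 * 3) 3 3 w ∧ w' = complexBetti.map g (2 * 3) w} ⊔
        Submodule.span ℂ {w' : complexBetti A.X (2 * 3) |
          ∃ (B' : AbelianVariety ℂ) (g : A.X ⟶ B'.X) (d : ℕ) (ψ : B' ⟶ B') (w : complexBetti B'.X (2 * 3)),
            B'.dim = 6 ∧ 0 < d ∧ ψ ≫ ψ = -(d • 𝟙 B') ∧ IsRationalClass w ∧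
            IsOfHodgeType B'.dim B'.X (2 * 3) 3 3 w ∧ w ∈ weilClassesOf B' ψ 3 d ∧
            w' = complexBetti.map g (2 * 3) w}) :=
  ⟨(codimTwoCensusAt_iff_of_isIsogenous hA).mpr (codimTwoCensusAt_prod_of_productSpan hB hC hS),
    (codimThreeCensusAt_iff_of_isIsogenous hA).mpr (codimThreeCensusAt_prod_of_productSpan hB hC hS)⟩

/-! ## §2 Instances from PROVED product-span theorems of the tree -/

/-- **ROW (a): a factor WITHOUT simple factor of type IV times a factor OF CM TYPE.** For `B` with
`HasNoTypeIVFactor B`, `C` of CM type (both of positive dimension) and every `A ∼ B × C`, both census conclusions hold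
at `A` — by the tree's THEOREM `Lombardo2016_hodgeClassesProductSpan_holds` (Lombardo 2016 Lemma 3.4:
`Hg(B × C) = Hg(B) × Hg(C)`; Moonen–Zarhin (3.1): hence product span). TABLE X rows «I/II/III-factor × CM factor».
[cite: Lombardo2016, Lemma 3.4 (p. 1229)] [cite: MoonenZarhin1999LowDim, §3 (3.1)] -/
theorem census_of_isIsogenous_prod_of_hasNoTypeIVFactor_of_isOfCMType {A B C : AbelianVariety ℂ} (hB : 0 < B.dim)
    (hC : 0 < C.dim) (hB4 : HasNoTypeIVFactor B) (hCcm : IsOfCMType C) (hA : IsIsogenous A (B.prod C)) :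
    (∀ c : complexBetti A.X (2 * 2), IsRationalClass c → IsOfHodgeType A.dim A.X (2 * 2) 2 2 c →
      c ∈ divisorClassesSpan A.X A.dim 2 ⊔ Submodule.span ℂ {w' : complexBetti A.X (2 * 2) |
        ∃ (C : AbelianVariety ℂ) (g : A.X ⟶ C.X) (w : complexBetti C.X (2 * 2)), C.dim < A.dim ∧
          IsRationalClass w ∧ IsOfHodgeType C.dim C.X (2 * 2) 2 2 w ∧ w' = complexBetti.map g (2 * 2) w}) ∧
    (∀ c : complexBetti A.X (2 * 3), IsRationalClass c → IsOfHodgeType A.dim A.X (2 * 3) 3 3 c →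
      c ∈ divisorClassesSpan A.X A.dim 3 ⊔ Submodule.span ℂ {w' : complexBetti A.X (2 * 3) |
          ∃ (a : complexBetti A.X (2 * 2)) (b : complexBetti A.X (2 * 1)),
            IsRationalClass a ∧ IsOfHodgeType A.dim A.X (2 * 2) 2 2 a ∧ IsRationalClass b ∧
            IsOfHodgeType A.dim A.X (2 * 1) 1 1 b ∧ w' = cupProduct (two_mul_add_two_mul 2 1) a b} ⊔
        Submodule.span ℂ {w' : complexBetti A.X (2 * 3) |
          ∃ (C : AbelianVariety ℂ) (g : A.X ⟶ C.X) (w : complexBetti C.X (2 * 3)), C.dim < A.dim ∧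
            IsRationalClass w ∧ IsOfHodgeType C.dim C.X (2 * 3) 3 3 w ∧ w' = complexBetti.map g (2 * 3) w} ⊔
        Submodule.span ℂ {w' : complexBetti A.X (2 * 3) |
          ∃ (B' : AbelianVariety ℂ) (g : A.X ⟶ B'.X) (d : ℕ) (ψ : B' ⟶ B') (w : complexBetti B'.X (2 * 3)),
            B'.dim = 6 ∧ 0 < d ∧ ψ ≫ ψ = -(d • 𝟙 B') ∧ IsRationalClass w ∧
            IsOfHodgeType B'.dim B'.X (2 * 3) 3 3 w ∧ w ∈ weilClassesOf B' ψ 3 d ∧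
            w' = complexBetti.map g (2 * 3) w}) :=
  census_of_isIsogenous_prod_of_productSpan hB hC (Lombardo2016_hodgeClassesProductSpan_holds B C hB4 hCcm) hA

/-- **ROW (b): anything times an elliptic curve with `End⁰ = ℚ` and no homomorphism to it.** For `E` an elliptic
curve with `dim_ℚ End⁰(E) = 1`, `B` of positive dimension with `Hom(B, E) = 0`, and every `A ∼ B × E`, both census
conclusions hold at `A` — by the tree's THEOREM `hodgeClassesProductSpan_of_nonCMCurve_of_forall_hom_eq_zero`
(Moonen–Zarhin Prop. (3.8): `Hg(B × E) = Hg(B) × Hg(E)` unless `End⁰(E) = k` embeds into the centre of `End⁰(B)`;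
Lemma (3.4)). [cite: MoonenZarhin1999LowDim, §3 (3.1), Lemma (3.4) and Prop. (3.8)] -/
theorem census_of_isIsogenous_prod_nonCMCurve {A B E : AbelianVariety ℂ} (hB : 0 < B.dim) (hE1 : E.dim = 1)
    (hEend : Module.finrank ℚ E.endAlgebra = 1) (hBE : ∀ u : B ⟶ E, u = 0) (hA : IsIsogenous A (B.prod E)) :
    (∀ c : complexBetti A.X (2 * 2), IsRationalClass c → IsOfHodgeType A.dim A.X (2 * 2) 2 2 c →
      c ∈ divisorClassesSpan A.X A.dim 2 ⊔ Submodule.span ℂ {w' : complexBetti A.X (2 * 2) |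
        ∃ (C : AbelianVariety ℂ) (g : A.X ⟶ C.X) (w : complexBetti C.X (2 * 2)), C.dim < A.dim ∧
          IsRationalClass w ∧ IsOfHodgeType C.dim C.X (2 * 2) 2 2 w ∧ w' = complexBetti.map g (2 * 2) w}) ∧
    (∀ c : complexBetti A.X (2 * 3), IsRationalClass c → IsOfHodgeType A.dim A.X (2 * 3) 3 3 c →
      c ∈ divisorClassesSpan A.X A.dim 3 ⊔ Submodule.span ℂ {w' : complexBetti A.X (2 * 3) |
          ∃ (a : complexBetti A.X (2 * 2)) (b : complexBetti A.X (2 * 1)),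
            IsRationalClass a ∧ IsOfHodgeType A.dim A.X (2 * 2) 2 2 a ∧ IsRationalClass b ∧
            IsOfHodgeType A.dim A.X (2 * 1) 1 1 b ∧ w' = cupProduct (two_mul_add_two_mul 2 1) a b} ⊔
        Submodule.span ℂ {w' : complexBetti A.X (2 * 3) |
          ∃ (C : AbelianVariety ℂ) (g : A.X ⟶ C.X) (w : complexBetti C.X (2 * 3)), C.dim < A.dim ∧
            IsRationalClass w ∧ IsOfHodgeType C.dim C.X (2 * 3) 3 3 w ∧ w' = complexBetti.map g (2 * 3) w} ⊔
        Submodule.span ℂ {w' : complexBetti A.X (2 * 3) |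
          ∃ (B' : AbelianVariety ℂ) (g : A.X ⟶ B'.X) (d : ℕ) (ψ : B' ⟶ B') (w : complexBetti B'.X (2 * 3)),
            B'.dim = 6 ∧ 0 < d ∧ ψ ≫ ψ = -(d • 𝟙 B') ∧ IsRationalClass w ∧
            IsOfHodgeType B'.dim B'.X (2 * 3) 3 3 w ∧ w ∈ weilClassesOf B' ψ 3 d ∧
            w' = complexBetti.map g (2 * 3) w}) :=
  census_of_isIsogenous_prod_of_productSpan hB (by omega)
    (hodgeClassesProductSpan_of_nonCMCurve_of_forall_hom_eq_zero hE1 hEend hBE) hA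

/-- **ROW (c): anything times a stably nondegenerate factor with `End⁰ = ℚ` and no homomorphism to it** (`S` of
positive dimension with `IsStablyNondegenerate S`, `dim_ℚ End⁰(S) = 1`, `Hom(B, S) = 0`): both census conclusions at
every `A ∼ B × S` — by the tree's THEOREM `hodgeClassesProductSpan_of_genericStablyNondegenerate_of_forall_hom_eq_zero`
(Hazama; Moonen–Zarhin (2.4), (3.1), Lemma (3.4)). [cite: MoonenZarhin1999LowDim, §2 (2.4), §3 (3.1) and Lemma (3.4)]
[cite: Hazama1989, Thm. (= Gordon 7.6.2)] -/
theorem census_of_isIsogenous_prod_genericStablyNondegenerate {A B S : AbelianVariety ℂ} (hB : 0 < B.dim)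
    (hS0 : 0 < S.dim) (hSnd : IsStablyNondegenerate S) (hSend : Module.finrank ℚ S.endAlgebra = 1)
    (hBS : ∀ u : B ⟶ S, u = 0) (hA : IsIsogenous A (B.prod S)) :
    (∀ c : complexBetti A.X (2 * 2), IsRationalClass c → IsOfHodgeType A.dim A.X (2 * 2) 2 2 c →
      c ∈ divisorClassesSpan A.X A.dim 2 ⊔ Submodule.span ℂ {w' : complexBetti A.X (2 * 2) |
        ∃ (C : AbelianVariety ℂ) (g : A.X ⟶ C.X) (w : complexBetti C.X (2 * 2)), C.dim < A.dim ∧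
          IsRationalClass w ∧ IsOfHodgeType C.dim C.X (2 * 2) 2 2 w ∧ w' = complexBetti.map g (2 * 2) w}) ∧
    (∀ c : complexBetti A.X (2 * 3), IsRationalClass c → IsOfHodgeType A.dim A.X (2 * 3) 3 3 c →
      c ∈ divisorClassesSpan A.X A.dim 3 ⊔ Submodule.span ℂ {w' : complexBetti A.X (2 * 3) |
          ∃ (a : complexBetti A.X (2 * 2)) (b : complexBetti A.X (2 * 1)),
            IsRationalClass a ∧ IsOfHodgeType A.dim A.X (2 * 2) 2 2 a ∧ IsRationalClass b ∧
            IsOfHodgeType A.dim A.X (2 * 1) 1 1 b ∧ w' = cupProduct (two_mul_add_two_mul 2 1) a b} ⊔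
        Submodule.span ℂ {w' : complexBetti A.X (2 * 3) |
          ∃ (C : AbelianVariety ℂ) (g : A.X ⟶ C.X) (w : complexBetti C.X (2 * 3)), C.dim < A.dim ∧
            IsRationalClass w ∧ IsOfHodgeType C.dim C.X (2 * 3) 3 3 w ∧ w' = complexBetti.map g (2 * 3) w} ⊔
        Submodule.span ℂ {w' : complexBetti A.X (2 * 3) |
          ∃ (B' : AbelianVariety ℂ) (g : A.X ⟶ B'.X) (d : ℕ) (ψ : B' ⟶ B') (w : complexBetti B'.X (2 * 3)),
            B'.dim = 6 ∧ 0 < d ∧ ψ ≫ ψ = -(d • 𝟙 B') ∧ IsRationalClass w ∧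
            IsOfHodgeType B'.dim B'.X (2 * 3) 3 3 w ∧ w ∈ weilClassesOf B' ψ 3 d ∧
            w' = complexBetti.map g (2 * 3) w}) :=
  census_of_isIsogenous_prod_of_productSpan hB hS0
    (hodgeClassesProductSpan_of_genericStablyNondegenerate_of_forall_hom_eq_zero hSnd hSend hBS) hA

/-! ## §3 The Künneth rows (a), (b) lie OFF the residue class `𝒞 = CM ∪ K3P` -/

/-- A variety isogenous to a product whose LEFT factor is not of CM type is not of CM type (CM type is an isogeny
invariant and passes to factors). [cite: Milne1999, §2 p. 54] [cite: Shimura1998, §5.1 Propositions 3, 4, 6] -/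
theorem not_isOfCMType_of_isIsogenous_prod_of_left {A B C : AbelianVariety ℂ} (hBcm : ¬ IsOfCMType B)
    (hA : IsIsogenous A (B.prod C)) : ¬ IsOfCMType A :=
  fun h ↦ hBcm ((isOfCMType_iff_of_isIsogenous hA).mp h).of_prod_left

/-- A variety isogenous to a product whose RIGHT factor is not of CM type is not of CM type.
[cite: Milne1999, §2 p. 54] [cite: Shimura1998, §5.1 Propositions 3, 4, 6] -/
theorem not_isOfCMType_of_isIsogenous_prod_of_right {A B C : AbelianVariety ℂ} (hCcm : ¬ IsOfCMType C)
    (hA : IsIsogenous A (B.prod C)) : ¬ IsOfCMType A :=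
  fun h ↦ hCcm ((isOfCMType_iff_of_isIsogenous hA).mp h).of_prod_right

/-- **ROW (a) IS NOT IN THE K3-PARTNER CELL.** If `A ∼ B × C` with `HasNoTypeIVFactor B` and `C` of CM type, then `A`
is not isogenous to `Y × Z` with `Y` a simple type-IV quartic-field fourfold and `Z` a CM surface: `Y` would be a simple
isogeny factor of `B × C` (Milne 1986 §12), i.e. of `B` — then `B ∼ Y × C''` and `Y ↪ Y × C''` inherits
`HasNoTypeIVFactor`, contradicting type IV — or of the CM variety `C` — then `End⁰(Y)` is a field of degree
`2 dim Y = 8` (Milne's clause at a simple isogeny factor), not `4`. [cite: Milne1986AbelianVarieties, §12 p. 122]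
[cite: Milne1999, §2 p. 54] [cite: MoonenZarhin1999LowDim, §1 (no factors of type IV)] -/
theorem not_prodCMCell_quarticTypeIV_of_isIsogenous_prod_of_hasNoTypeIVFactor_of_isOfCMType
    {A B C : AbelianVariety ℂ} (hB4 : HasNoTypeIVFactor B) (hCcm : IsOfCMType C) (hA : IsIsogenous A (B.prod C)) :
    ¬ ProdCMCell IsQuarticFieldTypeIVFourfold (fun Z ↦ Z.dim = 2) A := by
  rintro ⟨Y, Z, hYZ, hY, -, -⟩
  obtain ⟨hY4, hYs, -, hYrk, hYIV⟩ := hY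
  have hfacA : IsSimpleIsogenyFactor Y A :=
    (isSimpleIsogenyFactor_congr_right hYZ).mpr ((isSimpleIsogenyFactor_self hYs (by omega)).prod_left)
  have hfac : IsSimpleIsogenyFactor Y (B.prod C) := (isSimpleIsogenyFactor_congr_right hA).mp hfacA
  rcases isSimpleIsogenyFactor_prod_iff.mp hfac with h | h
  · obtain ⟨-, -, C'', hBY⟩ := h
    have hYC'' : HasNoTypeIVFactor (Y.prod C'') := hB4.of_isIsogenous hBY.symm'
    haveI := AbelianVariety.isClosedImmersion_prodLift_id_zero Y C''
    exact hYIV (hYC''.of_isClosedImmersion (AbelianVariety.prodLift (𝟙 Y) (0 : Y ⟶ C'')))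
  · have h8 := (isOfCMTypeSimple_of_isSimpleIsogenyFactor hCcm h).2
    omega

/-- **ROW (b) IS NOT IN THE K3-PARTNER CELL.** If `A ∼ B × E` with `E` an elliptic curve NOT of CM type, then `A` is not
in the K3-partner cell: `E` would be a simple isogeny factor of `Y × Z`, i.e. of the simple fourfold `Y` — then `E ∼ Y`,
`1 = 4` — or of the CM surface `Z` — then `E` would be of CM type. [cite: Milne1986AbelianVarieties, §12 p. 122]
[cite: Milne1999, §2 p. 54] [cite: MumfordAV1970, §19 Cor. 1–2 (pp. 173–174)] -/
theorem not_prodCMCell_quarticTypeIV_of_isIsogenous_prod_nonCMCurve {A B E : AbelianVariety ℂ} (hE1 : E.dim = 1)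
    (hEcm : ¬ IsOfCMType E) (hA : IsIsogenous A (B.prod E)) :
    ¬ ProdCMCell IsQuarticFieldTypeIVFourfold (fun Z ↦ Z.dim = 2) A := by
  rintro ⟨Y, Z, hYZ, hY, hZcm, -⟩
  obtain ⟨hY4, hYs, -⟩ := hY
  have hEs : E.IsSimple := AbelianVariety.isSimple_of_dim_le_one hE1.le
  have hfacA : IsSimpleIsogenyFactor E A :=
    (isSimpleIsogenyFactor_congr_right hA).mpr ((isSimpleIsogenyFactor_self hEs (by omega)).prod_right)
  have hfac : IsSimpleIsogenyFactor E (Y.prod Z) := (isSimpleIsogenyFactor_congr_right hYZ).mp hfacA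
  rcases isSimpleIsogenyFactor_prod_iff.mp hfac with h | h
  · have := ((isSimpleIsogenyFactor_iff_isIsogenous_of_isSimple hYs (by omega)).mp h).dim_eq
    omega
  · exact hEcm (isOfCMTypeSimple_of_isSimpleIsogenyFactor hZcm h).isOfCMType

/-- **Row (a) is off the residue class** (`𝒞` spelled exactly as in L6 / L7), for `B` moreover NOT of CM type.
[cite: Milne1999, §2 p. 54] [cite: Milne1986AbelianVarieties, §12 p. 122] -/
theorem not_residueClass_of_isIsogenous_prod_of_hasNoTypeIVFactor_of_isOfCMType {A B C : AbelianVariety ℂ}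
    (hB4 : HasNoTypeIVFactor B) (hBcm : ¬ IsOfCMType B) (hCcm : IsOfCMType C) (hA : IsIsogenous A (B.prod C)) :
    ¬ (IsOfCMType A ∨ ProdCMCell IsQuarticFieldTypeIVFourfold (fun Z ↦ Z.dim = 2) A) :=
  fun h ↦ h.elim (not_isOfCMType_of_isIsogenous_prod_of_left hBcm hA)
    (not_prodCMCell_quarticTypeIV_of_isIsogenous_prod_of_hasNoTypeIVFactor_of_isOfCMType hB4 hCcm hA)

/-- **Row (b) is off the residue class** (`𝒞` spelled exactly as in L6 / L7). [cite: Milne1999, §2 p. 54]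
[cite: Milne1986AbelianVarieties, §12 p. 122] -/
theorem not_residueClass_of_isIsogenous_prod_nonCMCurve {A B E : AbelianVariety ℂ} (hE1 : E.dim = 1)
    (hEcm : ¬ IsOfCMType E) (hA : IsIsogenous A (B.prod E)) :
    ¬ (IsOfCMType A ∨ ProdCMCell IsQuarticFieldTypeIVFourfold (fun Z ↦ Z.dim = 2) A) :=
  fun h ↦ h.elim (not_isOfCMType_of_isIsogenous_prod_of_right hEcm hA)
    (not_prodCMCell_quarticTypeIV_of_isIsogenous_prod_nonCMCurve hE1 hEcm hA)

end Summit.HodgeConjecture.HodgeConjecture.TableX.ProductRows
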